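import Summits.QuantumFields.YangMills.Theorems.ConvexGribovBodyNonSimplyConnectedLatticeGapDefs
import Summits.QuantumFields.YangMills.Theorems.ConvexGribovBodyNonSimplyConnectedLatticeGapStubMeanBoxInfluenceLeOfGoodSet
import HarnessLib

/-!
# `NonSimplyConnectedLatticeGap` — rarity of bad exterior data + weak mixing over good exterior data ⇒ the averaged
# half-torus leaf (stub `stub_halfTorusLeaf_of_rare_of_goodMixing` (TR) of line `Sketch` v11, crux
# stmt-QuantumFields-16405, route `ConvexGribovBody`)

Write `Λ_L = [−L,L]⁴ × univ` for the cube of links of radius `L`, `γ_{Λ_L}(A | η)` for the kernel mean of a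
gauge-invariant local observable `A` under the Wilson specification `ymSpecification r.ρ β Λ_L` with exterior datum `η`,
`μ_S = wilsonMeasure r.ρ β` for the torus Wilson state on `(2S+1)⁴`, `Ũ = torusLift (2S+1) U` for the periodic lift and
`Good_L = goodExterior r.ρ a L` for the good exterior data (no long chain of `a`-bad plaquettes in the shell around `Λ_L`).

* (P1) rarity: for every `a > 0`, at large `β`, `μ_S(Ũ ∉ Good_L) ≤ C₁ e^{−cL}` whenever `2L + 1 ≤ S`;
* (P2) good mixing: for some `a > 0`, at large `β`, `|γ_{Λ_L}(A | η) − γ_{Λ_L}(A | η')| ≤ C_A e^{−mL}` for all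
  `η, η' ∈ Good_L` and every `A` supported in `Λ_L`;
* (A‴) the averaged leaf: at large `β`, `∫ |γ_{Λ_L}(A | Ũ) − μ_S(A)| dμ_S(U) ≤ C e^{−m'L}` for `supp A ⊆ Λ_L`,
  `2L + 1 ≤ S`.

`(P1) → (P2) → (A‴)` is a pure composition of the landed stub GOOD
(`stub_meanBoxInfluence_le_of_goodSet`: `∫ |γ_{Λ_L}(A | Ũ) − μ_S(A)| dμ_S ≤ 2δ + 4‖A‖∞ ε` whenever `γ_{Λ_L}(A | ·)`
varies by `≤ δ` over a measurable set `Good` with `μ_S(Ũ ∉ Good) ≤ ε`) with the measurability of `goodExterior`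
(`stub_measurableSet_goodExterior`) and exponential arithmetic: `β`-threshold `max β₂ β₃`, rate `min m c`,
constant `2|C_A| + 4‖A‖∞|C₁|`.

References: H.-O. Georgii, *Gibbs Measures and Phase Transitions*, 2nd ed. (de Gruyter 2011), Thm. 4.17, §8.2.
-/

set_option autoImplicit false

noncomputable section

open MeasureTheory
open Literature.Probability.LatticeModels
open Literature.MathematicalPhysics.QuantumLattice
open Literature.MathematicalPhysics.QuantumFieldTheory (GaugeConfig wilsonMeasure LatticeRep YMSpecies
  IsCompactSimpleLieGroup)
open Summit.QuantumFields.YangMills.Cruxes.NonSimplyConnectedLatticeGap.Sketch (goodExterior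
  stub_measurableSet_goodExterior)

namespace Summit.QuantumFields.YangMills.Theorems.NonSimplyConnectedLatticeGap

/-- Exponential arithmetic: for `0 ≤ x`, `0 ≤ p`, `0 ≤ q` and rates `m, c`,
`2 (p e^{−m x}) + 4 K (q e^{−c x}) ≤ (2p + 4Kq) e^{−min(m,c) x}` (`0 ≤ K`). -/
theorem two_mul_add_four_mul_le_mul_exp_min {x p q K m c : ℝ} (hx : 0 ≤ x) (hp : 0 ≤ p) (hq : 0 ≤ q)
    (hK : 0 ≤ K) :
    2 * (p * Real.exp (-(m * x))) + 4 * K * (q * Real.exp (-(c * x))) ≤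
      (2 * p + 4 * K * q) * Real.exp (-(min m c * x)) := by
  have e1 : Real.exp (-(m * x)) ≤ Real.exp (-(min m c * x)) :=
    Real.exp_le_exp.2 (neg_le_neg (mul_le_mul_of_nonneg_right (min_le_left m c) hx))
  have e2 : Real.exp (-(c * x)) ≤ Real.exp (-(min m c * x)) :=
    Real.exp_le_exp.2 (neg_le_neg (mul_le_mul_of_nonneg_right (min_le_right m c) hx))
  have h1 : p * Real.exp (-(m * x)) ≤ p * Real.exp (-(min m c * x)) := mul_le_mul_of_nonneg_left e1 hp
  have h2 : q * Real.exp (-(c * x)) ≤ q * Real.exp (-(min m c * x)) := mul_le_mul_of_nonneg_left e2 hq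
  have h3 : 4 * K * (q * Real.exp (-(c * x))) ≤ 4 * K * (q * Real.exp (-(min m c * x))) :=
    mul_le_mul_of_nonneg_left h2 (by positivity)
  nlinarith only [h1, h3]

/-- **Rarity of bad exterior data (P1) + weak mixing uniformly over good exterior data (P2) ⇒ the averaged half-torus
leaf (A‴)** (registered stub `stub_halfTorusLeaf_of_rare_of_goodMixing` (TR) of the skeleton
`Cruxes/NonSimplyConnectedLatticeGap/Lines/Sketch.lean` v11 of item stmt-QuantumFields-16405): at `β ≥ max β₂ β₃`, with
`Good = goodExterior r.ρ a L` (measurable by `stub_measurableSet_goodExterior`), `δ = |C_A| e^{−mL}` and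
`ε = |C₁| e^{−cL}`, the landed stub `stub_meanBoxInfluence_le_of_goodSet` gives
`∫ |γ_{Λ_L}(A | Ũ) − μ_S(A)| dμ_S ≤ 2δ + 4‖A‖∞ ε ≤ (2|C_A| + 4‖A‖∞|C₁|) e^{−min(m,c) L}`. -/
theorem stub_halfTorusLeaf_of_rare_of_goodMixing : (∀ (G : Type) [Group G] [TopologicalSpace G] [IsTopologicalGroup G] [CompactSpace G] [MeasurableSpace G] [BorelSpace G], Literature.MathematicalPhysics.QuantumFieldTheory.IsCompactSimpleLieGroup G → ∀ r : Literature.MathematicalPhysics.QuantumFieldTheory.LatticeRep G, ∀ a : ℝ, 0 < a → ∃ β₃ : ℝ, ∀ β : ℝ, β₃ ≤ β → ∃ c : ℝ, 0 < c ∧ ∃ C : ℝ, ∀ (L S : ℕ), 2 * L + 1 ≤ S → ((Literature.MathematicalPhysics.QuantumFieldTheory.wilsonMeasure r.ρ β : MeasureTheory.Measure (Literature.MathematicalPhysics.QuantumFieldTheory.GaugeConfig 4 (2 * S + 1) G)) {V | Literature.MathematicalPhysics.QuantumLattice.torusLift (2 * S + 1) V ∉ Summit.QuantumFields.YangMills.Cruxes.NonSimplyConnectedLatticeGap.Sketch.goodExterior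 r.ρ a L}).toReal ≤ C * Real.exp (-(c * L))) → (∀ (G : Type) [Group G] [TopologicalSpace G] [IsTopologicalGroup G] [CompactSpace G] [MeasurableSpace G] [BorelSpace G], Literature.MathematicalPhysics.QuantumFieldTheory.IsCompactSimpleLieGroup G → ¬ SimplyConnectedSpace G → ∀ r : Literature.MathematicalPhysics.QuantumFieldTheory.LatticeRep G, ∃ a : ℝ, 0 < a ∧ ∃ β₂ : ℝ, ∀ β : ℝ, β₂ ≤ β → ∃ m : ℝ, 0 < m ∧ ∀ A : Literature.MathematicalPhysics.QuantumFieldTheory.YMSpecies G, ∃ C : ℝ, ∀ L : ℕ, A.supp ⊆ ((Fintype.piFinset fun _ : Fin 4 => Finset.Icc (-((L : ℕ) : ℤ)) ((L : ℕ) : ℤ)) ×ˢ (Finset.univ : Finset (Fin 4))) → ∀ η ∈ Summit.QuantumFields.YangMills.Cruxes.NonSimplyConnectedLatticeGap.Sketch.goodExterior r.ρ a L, ∀ η' ∈ Summit.QuantumFields.YangMills.Cruxes.NonSimplyConnectedLatticeGap.Sketch.goodExterior r.ρ a L, |(∫ U, A.F U ∂(Literature.MathematicalPhysics.QuantumLattice.ymSpecification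 r.ρ β ((Fintype.piFinset fun _ : Fin 4 => Finset.Icc (-((L : ℕ) : ℤ)) ((L : ℕ) : ℤ)) ×ˢ (Finset.univ : Finset (Fin 4))) η)) - ∫ U, A.F U ∂(Literature.MathematicalPhysics.QuantumLattice.ymSpecification r.ρ β ((Fintype.piFinset fun _ : Fin 4 => Finset.Icc (-((L : ℕ) : ℤ)) ((L : ℕ) : ℤ)) ×ˢ (Finset.univ : Finset (Fin 4))) η')| ≤ C * Real.exp (-(m * L))) → ∀ (G : Type) [Group G] [TopologicalSpace G] [IsTopologicalGroup G] [CompactSpace G] [MeasurableSpace G] [BorelSpace G], Literature.MathematicalPhysics.QuantumFieldTheory.IsCompactSimpleLieGroup G → ¬ SimplyConnectedSpace G → ∀ r : Literature.MathematicalPhysics.QuantumFieldTheory.LatticeRep G, ∃ β₂ : ℝ, ∀ β : ℝ, β₂ ≤ β → ∃ m : ℝ, 0 < m ∧ ∀ A : Literature.MathematicalPhysics.QuantumFieldTheory.YMSpecies G, ∃ C : ℝ, ∀ (L S : ℕ), A.supp ⊆ ((Fintype.piFinset fun _ : Fin 4 => Finset.Icc (-((L : ℕ) : ℤ)) ((L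 : ℕ) : ℤ)) ×ˢ (Finset.univ : Finset (Fin 4))) → 2 * L + 1 ≤ S → ∫ V, |(∫ U, A.F U ∂(Literature.MathematicalPhysics.QuantumLattice.ymSpecification r.ρ β ((Fintype.piFinset fun _ : Fin 4 => Finset.Icc (-((L : ℕ) : ℤ)) ((L : ℕ) : ℤ)) ×ˢ (Finset.univ : Finset (Fin 4))) (Literature.MathematicalPhysics.QuantumLattice.torusLift (2 * S + 1) V))) - ∫ W, A.F (Literature.MathematicalPhysics.QuantumLattice.torusLift (2 * S + 1) W) ∂(Literature.MathematicalPhysics.QuantumFieldTheory.wilsonMeasure r.ρ β : MeasureTheory.Measure (Literature.MathematicalPhysics.QuantumFieldTheory.GaugeConfig 4 (2 * S + 1) G))| ∂(Literature.MathematicalPhysics.QuantumFieldTheory.wilsonMeasure r.ρ β : MeasureTheory.Measure (Literature.MathematicalPhysics.QuantumFieldTheory.GaugeConfig 4 (2 * S + 1) G)) ≤ C * Real.exp (-(m * L)) := by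
  intro hP1 hP2 G _ _ _ _ _ _ hG hnsc r
  obtain ⟨a, ha, β₂, hβ₂⟩ := hP2 G hG hnsc r
  obtain ⟨β₃, hβ₃⟩ := hP1 G hG r a ha
  refine ⟨max β₂ β₃, fun β hβ => ?_⟩
  obtain ⟨m, hm, hmix⟩ := hβ₂ β ((le_max_left _ _).trans hβ)
  obtain ⟨c, hc, C₁, hrare⟩ := hβ₃ β ((le_max_right _ _).trans hβ)
  refine ⟨min m c, lt_min hm hc, fun A => ?_⟩
  obtain ⟨C_A, hmixA⟩ := hmix A
  obtain ⟨CA, hCA⟩ := A.bounded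
  have hCA0 : 0 ≤ CA := (abs_nonneg _).trans (hCA fun _ => 1)
  haveI : T2Space G := (r.continuous.isClosedEmbedding r.injective).isEmbedding.t2Space
  haveI : SecondCountableTopology G :=
    (r.continuous.isClosedEmbedding r.injective).isEmbedding.secondCountableTopology
  refine ⟨2 * |C_A| + 4 * CA * |C₁|, fun L S hsupp h2 => ?_⟩
  have hδ0 : 0 ≤ |C_A| * Real.exp (-(m * L)) := by positivity
  -- (P2) at `A`, with the non-negative constant `|C_A|`
  have hvar : ∀ η ∈ goodExterior r.ρ a L, ∀ η' ∈ goodExterior r.ρ a L,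
      |(∫ U, A.F U ∂(ymSpecification r.ρ β ((Fintype.piFinset fun _ : Fin 4 =>
          Finset.Icc (-((L : ℕ) : ℤ)) ((L : ℕ) : ℤ)) ×ˢ (Finset.univ : Finset (Fin 4))) η)) -
        ∫ U, A.F U ∂(ymSpecification r.ρ β ((Fintype.piFinset fun _ : Fin 4 =>
          Finset.Icc (-((L : ℕ) : ℤ)) ((L : ℕ) : ℤ)) ×ˢ (Finset.univ : Finset (Fin 4))) η')| ≤
        |C_A| * Real.exp (-(m * L)) :=
    fun η hη η' hη' => (hmixA L hsupp η hη η' hη').trans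
      (mul_le_mul_of_nonneg_right (le_abs_self _) (Real.exp_nonneg _))
  -- (P1), with the non-negative constant `|C₁|`
  have hε : ((wilsonMeasure (d := 4) (L := 2 * S + 1) r.ρ β)
      {V | torusLift (2 * S + 1) V ∉ goodExterior r.ρ a L}).toReal ≤ |C₁| * Real.exp (-(c * L)) :=
    (hrare L S h2).trans (mul_le_mul_of_nonneg_right (le_abs_self _) (Real.exp_nonneg _))
  -- GOOD
  have key := stub_meanBoxInfluence_le_of_goodSet G r.N r.ρ r.continuous β A CA hCA L S hsupp (by omega)
    (goodExterior r.ρ a L) (stub_measurableSet_goodExterior G r.N r.ρ r.continuous a L) _ _ hδ0 hvar hε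
  exact key.trans (two_mul_add_four_mul_le_mul_exp_min (Nat.cast_nonneg L) (abs_nonneg _) (abs_nonneg _) hCA0)

end Summit.QuantumFields.YangMills.Theorems.NonSimplyConnectedLatticeGap

end
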